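import Summits.Ventures.CertifiedQuantumChemistry.Rows.V2RDMDualKernelSliced
import HarnessLib

/-!
# Ventures/CertifiedQuantumChemistry — Rows/V2RDMDualKernelSegments.lean: the sliced staged kernel entry point with the FINAL ℓ¹ CUT BY KEY RANGE

HONEST FRAMING (verbatim): certified bounds for a stated model Hamiltonian in a stated basis; not a
claim about the real molecule beyond that model.

WHY. `V2RDMDual.lowerRow_of_sliced` (`Rows/V2RDMDualKernelSliced.lean`) ends in ONE kernel fact
`decide (lo ≤ E_core + Σ chunk constants − ℓ¹(mergeRuns (2k) (P :: M₂))) = true`: the merge of the objective polynomial with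
every last-stage residual literal and its ℓ¹ norm in a single `decide +kernel`. For the Hubbard ring `L = 10` certificate of
CERTIFIED row #185 (`Certificates/HubbardRingL10U10055DQGKernelLower.lean` as emitted: 15 key-sorted runs, 55 676 input terms)
that one evaluation needs ≈ 19 GB of kernel heap above the import baseline (measured 2026-08-27, var-2 g33: VmHWM 25.2 GB) and
aborts under the farm's per-process budget. Its soundness, however, never uses that the merge is complete — only that merging
preserves the value (`termsVal_mergeRuns`, any inputs) and that a form is bounded below by minus its ℓ¹ norm (`neg_l1_le`).
Hence the final list may be FILTERED into disjoint key ranges, each range merged and ℓ¹-summed in ITS OWN kernel fact, and the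
closing inequality stated against the SUM of the per-range norms: `lowerRow_of_sliced_seg` below. The ranges are the fibres of a
FUNCTION of the sort key (`segIdx`), so they partition every term list with no side condition, and equal descriptors (equal keys)
always share a range (so per-range grouping loses nothing when the runs are key-sorted). Pure addition: no existing declaration is
touched; `lowerRow_of_sliced` remains the entry point for certificates whose final merge fits one declaration.
-/

namespace Summit.Ventures.CertifiedQuantumChemistry

open Matrix Finset
open scoped ComplexOrder
open Literature.MathematicalPhysics.QuantumLattice Literature.MathematicalPhysics.QuantumChemistry

namespace V2RDMDual

/-- The index of the key range a term falls in: the number of cut points `≤` its sort key (`0 … cuts.length`;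
range `j` = keys in `[cuts[j-1], cuts[j])` for sorted cuts, but NO sortedness is needed for soundness). -/
def segIdx (n : ℕ) (cuts : List ℕ) (t : Term) : ℕ := cuts.countP fun c => decide (c ≤ t.2.key n)

/-- Every run filtered to key range `j`. -/
def segRuns (n : ℕ) (cuts : List ℕ) (j : ℕ) (ls : List (List Term)) : List (List Term) :=
  ls.map fun l => l.filter fun t => decide (segIdx n cuts t = j)

/-- A term's range index is at most the number of cuts. -/
theorem segIdx_le (n : ℕ) (cuts : List ℕ) (t : Term) : segIdx n cuts t ≤ cuts.length :=
  List.countP_le_length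

section Semantics

variable {k : ℕ} [NeZero k] {γ : M1 k} {Γ : M2 k}

/-- A form's value is the sum, over `s > #cuts` key ranges, of the values of its range-filtered parts. -/
theorem termsVal_eq_sum_seg (n : ℕ) (cuts : List ℕ) (s : ℕ) (hs : cuts.length < s) :
    ∀ l : List Term, termsVal k γ Γ l =
      ∑ j ∈ Finset.range s, termsVal k γ Γ (l.filter fun t => decide (segIdx n cuts t = j))
  | [] => by simp
  | t :: l => by
    rw [termsVal_cons, termsVal_eq_sum_seg n cuts s hs l]
    have ht : segIdx n cuts t ∈ Finset.range s := Finset.mem_range.2 (lt_of_le_of_lt (segIdx_le n cuts t) hs)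
    have e : ∀ j, termsVal k γ Γ ((t :: l).filter fun t => decide (segIdx n cuts t = j)) =
        (if segIdx n cuts t = j then (t.1 : ℝ) * Desc.val k γ Γ t.2 else 0) +
          termsVal k γ Γ (l.filter fun t => decide (segIdx n cuts t = j)) := by
      intro j
      rw [List.filter_cons]
      by_cases h : segIdx n cuts t = j
      · simp [h]
      · simp [h]
    simp_rw [e, Finset.sum_add_distrib, Finset.sum_ite_eq, if_pos ht]

/-- The summed value of a list of runs, split by key range run by run. -/
theorem sum_termsVal_eq_sum_seg (n : ℕ) (cuts : List ℕ) (s : ℕ) (hs : cuts.length < s) :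
    ∀ L : List (List Term), (L.map (termsVal k γ Γ)).sum =
      ∑ j ∈ Finset.range s, (L.map fun l => termsVal k γ Γ (l.filter fun t => decide (segIdx n cuts t = j))).sum
  | [] => by simp
  | l :: L => by
    simp_rw [List.map_cons, List.sum_cons]
    rw [Finset.sum_add_distrib, ← sum_termsVal_eq_sum_seg n cuts s hs L, termsVal_eq_sum_seg n cuts s hs l]

/-- The summed value of a list of runs equals the sum over key ranges of the values of the MERGED range-filtered runs. -/
theorem sum_termsVal_eq_sum_seg_mergeRuns (n : ℕ) (cuts : List ℕ) (s : ℕ) (hs : cuts.length < s)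
    (L : List (List Term)) :
    (L.map (termsVal k γ Γ)).sum = ∑ j ∈ Finset.range s, termsVal k γ Γ (mergeRuns n (segRuns n cuts j L)) := by
  rw [sum_termsVal_eq_sum_seg n cuts s hs L]
  refine Finset.sum_congr rfl fun j _ => ?_
  rw [termsVal_mergeRuns, segRuns, List.map_map]
  rfl

end Semantics

/-- **SLICED STAGED KERNEL ENTRY POINT, FINAL ℓ¹ BY KEY SEGMENTS**: as `lowerRow_of_sliced`, but the final check is given
in parts — validity (`hv`), length bookkeeping (`hlen`, the conjunction of `SCertS.finalCheck_of_parts`), ONE kernel fact per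
key range `j < s` equating the ℓ¹ norm of the merged range-`j`-filtered final runs `P :: M₂` with a literal (`hS`), and the
closing inequality against the literals' sum (`hlo`) — so that no single declaration has to merge the whole final list. -/
theorem lowerRow_of_sliced_seg {k : ℕ} [NeZero k] (F : Model k) (hF : F.IsSymmetric) (a b : ℕ) (ha : a ≤ k) (hb : b ≤ k)
    (hab : a + b ≠ 0) (hcard : a + b + 2 ≤ 2 * k) (c : SCertS) (P : List Term) (hP : IsObjPoly F P)
    (R : List (ℚ × List Term)) (m : ℕ) (hm : c.numChunks = m)
    (hR : ∀ i : Fin m, chunkOut (2 * k) ((SCertS.chunkRows k a b c).getD i (0, [])) = R.getD i (0, []))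
    (gs₁ : List ℕ) (M₁ : List (List Term)) (q₁ : ℕ) (hq₁ : gs₁.length = q₁)
    (hM₁ : ∀ g : Fin q₁, mergeRuns (2 * k) ((takeGroups gs₁ (R.map Prod.snd)).getD g []) = M₁.getD g [])
    (gs₂ : List ℕ) (M₂ : List (List Term)) (q₂ : ℕ) (hq₂ : gs₂.length = q₂)
    (hM₂ : ∀ g : Fin q₂, mergeRuns (2 * k) ((takeGroups gs₂ M₁).getD g []) = M₂.getD g [])
    (hv : SCertS.valid k c = true)
    (hlen : (decide (R.length = c.numChunks) && decide (gs₁.sum = R.length) && decide (M₁.length = gs₁.length) &&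
      decide (gs₂.sum = M₁.length) && decide (M₂.length = gs₂.length)) = true)
    (cuts : List ℕ) (S : List ℚ) (s : ℕ) (hs : cuts.length + 1 = s) (hSl : S.length = s)
    (hS : ∀ j : Fin s, l1 (mergeRuns (2 * k) (segRuns (2 * k) cuts j (P :: M₂))) = S.getD j 0)
    (hlo : decide (c.lo ≤ F.ecore + (R.map Prod.fst).sum - S.sum) = true) : LowerRow F a b c.lo := by
  refine ⟨ha, hb, ?_⟩
  simp only [Bool.and_eq_true, decide_eq_true_eq] at hlen hlo
  obtain ⟨⟨⟨⟨hlenR, hgs₁⟩, hM₁l⟩, hgs₂⟩, hM₂l⟩ := hlen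
  show ((c.lo : ℚ) : ℝ) ≤ sectorGroundEnergy F.hamiltonian a b
  refine le_sectorGroundEnergy_of_forall_isDQGFeasibleSector (Model.hamiltonian_isHermitian hF)
    (by simpa using ha) (by simpa using hb) fun γ Γ hfeas => ?_
  have hr : a + b + 2 ≤ Fintype.card (Orb (Fin k)) := by rw [card_orb_fin]; exact hcard
  rw [re_rdmEnergy_eq]
  have hchunks := SCertS.chunkRows_val_le (k := k) (γ := γ) (Γ := Γ) c hfeas hab hr hv
  have hlenC : (SCertS.chunkRows k a b c).length = m := by rw [SCertS.chunkRows_length, hm]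
  have hlenR' : R.length = m := by rw [hlenR, hm]
  -- the chunk values through the literals (as in `lowerRow_of_sliced`)
  have e1 : rowsVal (k := k) (γ := γ) (Γ := Γ) (SCertS.chunkRows k a b c) =
      ((R.map Prod.fst).sum : ℚ) + ((R.map Prod.snd).map (termsVal k γ Γ)).sum := by
    rw [rowsVal, sum_map_eq_sum_fin _ (0, []), List.map_map, sum_map_eq_sum_fin _ (0, []) R,
      sum_map_eq_sum_fin _ (0, []) R, hlenC, hlenR']
    push_cast
    rw [← Finset.sum_add_distrib]
    refine Finset.sum_congr rfl fun i _ => ?_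
    have hi := hR i
    simp only [chunkOut, Prod.ext_iff] at hi
    rw [rowVal, hi.1, Function.comp_apply, ← hi.2, termsVal_residual hfeas.dqg]
  -- the two merge stages through the literals
  have eM₁ : (M₁.map (termsVal k γ Γ)).sum = ((R.map Prod.snd).map (termsVal k γ Γ)).sum :=
    sum_termsVal_stage (2 * k) gs₁ (R.map Prod.snd) M₁ q₁ hq₁ (by rw [hgs₁, List.length_map]) (by rw [hM₁l, hq₁]) hM₁
  have eM₂ : (M₂.map (termsVal k γ Γ)).sum = (M₁.map (termsVal k γ Γ)).sum :=
    sum_termsVal_stage (2 * k) gs₂ M₁ M₂ q₂ hq₂ hgs₂ (by rw [hM₂l, hq₂]) hM₂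
  -- the final runs' total value, and its lower bound by key segments
  have eL : ((P :: M₂).map (termsVal k γ Γ)).sum =
      termsVal k γ Γ (objTerms F) + ((R.map Prod.snd).map (termsVal k γ Γ)).sum := by
    rw [List.map_cons, List.sum_cons, hP _ γ Γ hfeas.dqg, eM₂, eM₁]
  have eS : ∀ j ∈ Finset.range s,
      -((S.getD j 0 : ℚ) : ℝ) ≤ termsVal k γ Γ (mergeRuns (2 * k) (segRuns (2 * k) cuts j (P :: M₂))) := by
    intro j hj
    rw [← hS ⟨j, Finset.mem_range.1 hj⟩]
    exact neg_l1_le (abs_val_le_one (k := k) hfeas.dqg hr) _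
  have hSsum : ((S.sum : ℚ) : ℝ) = ∑ j ∈ Finset.range s, ((S.getD j 0 : ℚ) : ℝ) := by
    have h := sum_map_eq_sum_fin (fun q : ℚ => (q : ℝ)) 0 S
    rw [hSl, Fin.sum_univ_eq_sum_range (fun j => ((S.getD j 0 : ℚ) : ℝ)) s] at h
    rw [Rat.cast_list_sum]
    exact h
  have eSum : -((S.sum : ℚ) : ℝ) ≤ ((P :: M₂).map (termsVal k γ Γ)).sum := by
    rw [sum_termsVal_eq_sum_seg_mergeRuns (2 * k) cuts s (by omega) (P :: M₂), hSsum, ← Finset.sum_neg_distrib]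
    exact Finset.sum_le_sum eS
  have h3 : ((c.lo : ℚ) : ℝ) ≤ (F.ecore : ℝ) + ((R.map Prod.fst).sum : ℚ) - ((S.sum : ℚ) : ℝ) := by exact_mod_cast hlo
  linarith

end V2RDMDual

end Summit.Ventures.CertifiedQuantumChemistry
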